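import Literature.GroupTheory.TransversalAvoidingTranslate
import HarnessLib

/-!
# Half systems `N ∪ c(H ∖ N)` on a group with a central involution `c` and a subgroup `H` of index `2` avoiding `c`

COR-CM (cell `pub-hodgecm2`), binder seat b04 (gen 19), count-neutral claim GALOIS-TWICE-ODD, part II (pure group
theory, Mathlib only).  KERNEL ONLY: theorems; no definition, no named fact, no `sorry`.  `HC_CM` is neither used
nor claimed.

SETTING (the Galois group of a Galois CM field with an imaginary quadratic subfield `k`, Dodson's `⟨ρ⟩ × G₀`): a
finite group `G`, a central involution `c` (complex conjugation), a subgroup `H` with `c ∉ H` and `G = H ∪ cH`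
(`H = Gal(K/k)`), so that `G = ⟨c⟩ × H`.  For `N ⊆ H` the **half system** of `N` is

  `S = N ∪ c·(H ∖ N)`,   i.e. `g ∈ S ↔ g ∈ N ∨ (g ∉ H ∧ c g ∉ N)`,

a CM set for `c` (`g ∈ S ↔ c g ∉ S`, `isCM_halfSystem`); its right translates are the half systems of `N y` and of
`H ∖ N y` (`y ∈ H`).  Two facts feed the field dress (part III):

* §2 **`exists_not_iff_of_halfSystem`** — if `N` has trivial left stabiliser in `H` and `2|N| ≠ |H|`, then `S` has
  trivial left stabiliser in `G` (a stabilising `v = c h₁ ∉ H` would make `x ↦ h₁ x` exchange `N` and `H ∖ N`):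
  Shimura's primitivity criterion for the CM type read by `S`.
* §3 **`two_mul_card_filter_halfSystem`** — if `N` is a right transversal of a subgroup `V ≤ H` (`|N ∩ V y| = 1` for
  all `y ∈ H`) and `y₀ ∈ H ∖ V`, the set `D = V ∪ c·V·y₀` of `2|V|` elements is BALANCED for `S`: every right
  translate `S g` contains exactly `|V|` elements of `D` (`|M ∩ V| = |M ∩ V y₀|` for `M = N y` and `M = H ∖ N y`),
  while `1 ∈ D`, `c ∉ D` — Pohlmann's condition for a weight that is NOT conjugation-invariant, i.e. the CM type is
  DEGENERATE (constant weight criterion; the tree's `IsNondegenerate.symm_of_isBalanced`).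
* §4 **`exists_halfSystem_of_subgroup`** packages parts I + II: `V ≤ H` with `3 ≤ |V|` and a non-involution
  `y₀ ∈ H ∖ V` give a CM set `S` with trivial left stabiliser and a balanced finset `D ∋ 1`, `c ∉ D`.

## References

* [Dodson1984] B. Dodson, *The structure of Galois groups of CM-fields*, Trans. AMS 283 (1984), §3.1.1 (the constant
  weight criterion on `⟨ρ⟩ × G₀`).
* [Shimura1998] G. Shimura, *Abelian Varieties with Complex Multiplication and Modular Functions*, §8.2 Prop. 26.
* [Gordon1999HodgeAVSurvey] B. B. Gordon, *A survey of the Hodge conjecture for abelian varieties*, 9.2 (9.2.1), 9.2.2.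

Provenance: Literature home (namespace `Literature.NumberTheory.ComplexMultiplication.TwiceOdd`) of the Summits-side `CorCM/ImaginaryQuadraticHalfSystems` (cell `pub-hodgecm2`, COR-CM; all its imports are `Literature/`, Mathlib and the already re-homed `TransversalAvoidingTranslate`), which `Literature/` may not import; theorems only, no named fact, no definition. Nothing here bears on `HC_CM`. Lane `lit-hodgefound` (Layer A3: CM types, their Kubota ranks and Galois combinatorics), seat p20.
-/

namespace Literature.NumberTheory.ComplexMultiplication.TwiceOdd

open Literature.GroupTheory.TwiceOdd

open scoped Classical

variable {G : Type*} [Group G]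

/-! ## §1 Half systems are CM sets -/

section HalfSystem

variable {c : G} {H : Subgroup G} {N S : Finset G}

/-- `G = H ∪ cH` with `c ∉ H`: `c g ∈ H ↔ g ∉ H`. [cite: Dodson1984, §3.1.1] -/
theorem mul_mem_iff_not_mem (hcH : c ∉ H) (hH : ∀ g : G, g ∈ H ∨ c * g ∈ H) (g : G) :
    c * g ∈ H ↔ g ∉ H := by
  constructor
  · intro hcg hg
    exact hcH (by simpa using H.mul_mem hcg (H.inv_mem hg))
  · intro hg
    exact (hH g).resolve_left hg

/-- The half system of `N ⊆ H` exists as a finset: `g ∈ S ↔ g ∈ N ∨ (g ∉ H ∧ c g ∉ N)`. [cite: Dodson1984, §3.1.1] -/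
theorem exists_halfSystem [Fintype G] (c : G) (H : Subgroup G) (N : Finset G) :
    ∃ S : Finset G, ∀ g : G, g ∈ S ↔ g ∈ N ∨ (g ∉ H ∧ c * g ∉ N) :=
  ⟨Finset.univ.filter fun g => g ∈ N ∨ (g ∉ H ∧ c * g ∉ N), fun g => by simp⟩

/-- **The half system `S = N ∪ c(H ∖ N)` is a CM set for `c`**: `g ∈ S ↔ c g ∉ S` ("every embedding is among
`{φ₁, φ̄₁, …, φₙ, φ̄ₙ}`"). [cite: Dodson1984, §3.1.1] -/
theorem isCM_halfSystem (hcc : c * c = 1) (hcH : c ∉ H) (hH : ∀ g : G, g ∈ H ∨ c * g ∈ H)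
    (hNH : ∀ n ∈ N, n ∈ H) (hS : ∀ g : G, g ∈ S ↔ g ∈ N ∨ (g ∉ H ∧ c * g ∉ N)) (g : G) :
    g ∈ S ↔ c * g ∉ S := by
  have hccg : c * (c * g) = g := by rw [← mul_assoc, hcc, one_mul]
  rw [hS g, hS (c * g), hccg, mul_mem_iff_not_mem hcH hH]
  by_cases hg : g ∈ H
  · have hcg : c * g ∉ N := fun h => ((mul_mem_iff_not_mem hcH hH g).1 (hNH _ h)) hg
    constructor
    · rintro (hgN | ⟨hgH, -⟩)
      · rintro (h | ⟨-, h⟩)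
        · exact hcg h
        · exact h hgN
      · exact (hgH hg).elim
    · intro h
      left
      by_contra hgN
      exact h (Or.inr ⟨fun h' => h' hg, hgN⟩)
  · have hgN : g ∉ N := fun h => hg (hNH _ h)
    constructor
    · rintro (h | ⟨-, hcg⟩)
      · exact (hgN h).elim
      · rintro (h | ⟨h, -⟩)
        · exact hcg h
        · exact h hg
    · intro h
      right
      exact ⟨hg, fun hcg => h (Or.inl hcg)⟩

/-- Membership in a half system for elements of `H`: `g ∈ S ↔ g ∈ N`. [cite: Dodson1984, §3.1.1] -/
theorem mem_halfSystem_iff_of_mem (hS : ∀ g : G, g ∈ S ↔ g ∈ N ∨ (g ∉ H ∧ c * g ∉ N)) {g : G} (hg : g ∈ H) :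
    g ∈ S ↔ g ∈ N := by
  rw [hS]
  exact ⟨fun h => h.elim id fun h => (h.1 hg).elim, Or.inl⟩

/-- Membership in a half system for elements outside `H`: `g ∈ S ↔ c g ∉ N`. [cite: Dodson1984, §3.1.1] -/
theorem mem_halfSystem_iff_of_not_mem (hNH : ∀ n ∈ N, n ∈ H)
    (hS : ∀ g : G, g ∈ S ↔ g ∈ N ∨ (g ∉ H ∧ c * g ∉ N)) {g : G} (hg : g ∉ H) : g ∈ S ↔ c * g ∉ N := by
  rw [hS]
  exact ⟨fun h => h.elim (fun h => (hg (hNH _ h)).elim) And.right, fun h => Or.inr ⟨hg, h⟩⟩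

/-! ## §2 Trivial left stabiliser -/

/-- **The half system of `N` has trivial left stabiliser in `G`** when `N` has trivial left stabiliser in `H` and
`2|N| ≠ |H|`: for `v ∈ H`, `vS = S` gives `vN ⊆ N`; for `v = c h₁ ∉ H`, `vS = S` gives `h₁(H ∖ N) ⊆ N` and
`h₁ N ⊆ H ∖ N`, so `|N| = |H ∖ N|`.  In the form consumed by the tree's primitivity criterion
(`GaloisTable.exists_isPrimitive_of_tableModel`). [cite: Shimura1998, §8.2 Prop. 26] -/
theorem exists_not_iff_of_halfSystem [Fintype G] (hcc : c * c = 1) (hcz : ∀ g : G, c * g = g * c)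
    (hcH : c ∉ H) (hH : ∀ g : G, g ∈ H ∨ c * g ∈ H) (hNH : ∀ n ∈ N, n ∈ H)
    (hS : ∀ g : G, g ∈ S ↔ g ∈ N ∨ (g ∉ H ∧ c * g ∉ N)) (hN1 : ∀ u : G, (∀ n ∈ N, u * n ∈ N) → u = 1)
    (hcard : 2 * N.card ≠ Nat.card H) (v : G) (hv : v ≠ 1) : ∃ w : G, ¬ (w ∈ S ↔ v * w ∈ S) := by
  by_contra hall
  push Not at hall
  by_cases hvH : v ∈ H
  · -- `v N ⊆ N`
    refine hv (hN1 v fun n hn => ?_)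
    have h1 : n ∈ S := (mem_halfSystem_iff_of_mem hS (hNH n hn)).2 hn
    have h2 : v * n ∈ S := (hall n).1 h1
    exact (mem_halfSystem_iff_of_mem hS (H.mul_mem hvH (hNH n hn))).1 h2
  · -- `v = c h₁`, `h₁ ∈ H`, exchanges `N` and `H ∖ N`
    set h₁ : G := c * v with hh₁
    have hh₁H : h₁ ∈ H := (mul_mem_iff_not_mem hcH hH v).2 hvH
    have hvh : v = c * h₁ := by rw [hh₁, ← mul_assoc, hcc, one_mul]
    set HF : Finset G := Finset.univ.filter fun g => g ∈ H with hHF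
    have hmemH : ∀ g, g ∈ HF ↔ g ∈ H := fun g => by rw [hHF, Finset.mem_filter]; simp
    have hNsub : N ⊆ HF := fun n hn => (hmemH n).2 (hNH n hn)
    have hHFc : HF.card = Nat.card H := by rw [hHF, Nat.card_eq_fintype_card, ← Fintype.card_subtype]
    -- `h₁ (H ∖ N) ⊆ N`
    have hA : Set.MapsTo (fun x => h₁ * x) ↑(HF \ N) ↑N := by
      intro x hx
      rw [Finset.coe_sdiff, Set.mem_sdiff, Finset.mem_coe, Finset.mem_coe, hmemH] at hx
      obtain ⟨hxH, hxN⟩ := hx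
      have hw : c * x ∉ H := fun h => ((mul_mem_iff_not_mem hcH hH x).1 h) hxH
      have hwS : c * x ∈ S := (mem_halfSystem_iff_of_not_mem hNH hS hw).2 (by
        rw [← mul_assoc, hcc, one_mul]; exact hxN)
      have hvw : v * (c * x) ∈ S := (hall _).1 hwS
      have heq : v * (c * x) = h₁ * x := by rw [hh₁, ← mul_assoc, ← hcz v]
      rw [heq] at hvw
      exact (mem_halfSystem_iff_of_mem hS (H.mul_mem hh₁H hxH)).1 hvw
    -- `h₁ N ⊆ H ∖ N`
    have hB : Set.MapsTo (fun x => h₁ * x) ↑N ↑(HF \ N) := by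
      intro n hn
      rw [Finset.mem_coe] at hn
      rw [Finset.coe_sdiff, Set.mem_sdiff, Finset.mem_coe, Finset.mem_coe, hmemH]
      have hnS : n ∈ S := (mem_halfSystem_iff_of_mem hS (hNH n hn)).2 hn
      have hvn : v * n ∈ S := (hall n).1 hnS
      have hvnH : v * n ∉ H := by
        rw [hvh, mul_assoc]
        exact fun h => ((mul_mem_iff_not_mem hcH hH _).1 h) (H.mul_mem hh₁H (hNH n hn))
      have h := (mem_halfSystem_iff_of_not_mem hNH hS hvnH).1 hvn
      rw [hvh, mul_assoc, ← mul_assoc c c, hcc, one_mul] at h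
      exact ⟨H.mul_mem hh₁H (hNH n hn), h⟩
    have hinj : ∀ s : Finset G, Set.InjOn (fun x => h₁ * x) ↑s := fun s x _ y _ hxy => mul_left_cancel hxy
    have h1 := Finset.card_le_card_of_injOn _ hA (hinj _)
    have h2 := Finset.card_le_card_of_injOn _ hB (hinj _)
    rw [Finset.card_sdiff_of_subset hNsub] at h1 h2
    have h3 := Finset.card_le_card hNsub
    apply hcard
    rw [← hHFc]
    omega

/-! ## §3 A balanced set moved by `c` -/

variable {V : Subgroup G} {y₀ : G}

/-- One element of `V` per right coset hits `N`: `#{v ∈ V : v y ∈ N} = 1` for `y ∈ H` (right transversal). [cite: Dodson1984, §3.1.1] -/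
theorem card_filter_mul_mem_eq_one (hT : ∀ y ∈ H, ∃ v ∈ V, v * y ∈ N ∧ ∀ v' ∈ V, v' * y ∈ N → v' = v)
    {VF : Finset G} (hmemV : ∀ x, x ∈ VF ↔ x ∈ V) {y : G} (hy : y ∈ H) :
    (VF.filter fun v => v * y ∈ N).card = 1 := by
  obtain ⟨v, hv, hvy, huniq⟩ := hT y hy
  rw [Finset.card_eq_one]
  refine ⟨v, Finset.ext fun v' => ?_⟩
  simp only [Finset.mem_filter, hmemV, Finset.mem_singleton]
  exact ⟨fun h => huniq v' h.1 h.2, fun h => by rw [h]; exact ⟨hv, hvy⟩⟩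

/-- Hence `#{v ∈ V : v y ∉ N} = |V| − 1` for `y ∈ H`. [cite: Dodson1984, §3.1.1] -/
theorem card_filter_mul_not_mem (hT : ∀ y ∈ H, ∃ v ∈ V, v * y ∈ N ∧ ∀ v' ∈ V, v' * y ∈ N → v' = v)
    {VF : Finset G} (hmemV : ∀ x, x ∈ VF ↔ x ∈ V) {y : G} (hy : y ∈ H) :
    (VF.filter fun v => v * y ∉ N).card + 1 = VF.card := by
  rw [← card_filter_mul_mem_eq_one hT hmemV hy, add_comm]
  exact Finset.card_filter_add_card_filter_not _

variable [Fintype G]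

/-- **The balanced set.**  `N ⊆ H` a right transversal of `V ≤ H`, `y₀ ∈ H ∖ V`, `S` the half system of `N`,
`D = V ∪ c·V·y₀`.  Then every right translate `S g` contains exactly half of `D`:
`2 · #{x ∈ D : x g ∈ S} = #D` — Pohlmann's condition (9.2.1) for the multiset `D`, i.e. `|M ∩ V| = |M ∩ V y₀|`
for `M ∈ {N y, H ∖ N y}`. [cite: Dodson1984, §3.1.1] [cite: Gordon1999HodgeAVSurvey, §9.2 (9.2.1)] -/
theorem two_mul_card_filter_halfSystem (hcc : c * c = 1) (hcz : ∀ g : G, c * g = g * c) (hcH : c ∉ H)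
    (hH : ∀ g : G, g ∈ H ∨ c * g ∈ H) (hVH : V ≤ H) (hNH : ∀ n ∈ N, n ∈ H)
    (hT : ∀ y ∈ H, ∃ v ∈ V, v * y ∈ N ∧ ∀ v' ∈ V, v' * y ∈ N → v' = v)
    (hS : ∀ g : G, g ∈ S ↔ g ∈ N ∨ (g ∉ H ∧ c * g ∉ N)) (hy₀H : y₀ ∈ H) (g : G) :
    2 * (((Finset.univ.filter fun x : G => x ∈ V) ∪
        (Finset.univ.filter fun x : G => x ∈ V).image fun v => c * v * y₀).filter fun x => x * g ∈ S).card =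
      ((Finset.univ.filter fun x : G => x ∈ V) ∪
        (Finset.univ.filter fun x : G => x ∈ V).image fun v => c * v * y₀).card := by
  set VF : Finset G := Finset.univ.filter fun x : G => x ∈ V with hVF
  have hmemV : ∀ x, x ∈ VF ↔ x ∈ V := fun x => by rw [hVF, Finset.mem_filter]; simp
  set f : G → G := fun v => c * v * y₀ with hf
  have hfinj : Function.Injective f := by
    intro a b h
    have h' : c * a * y₀ = c * b * y₀ := h
    exact mul_left_cancel (mul_right_cancel h')
  -- the two halves of `D` are disjoint (`V ⊆ H`, `c V y₀ ∩ H = ∅`)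
  have hfH : ∀ v ∈ VF, f v ∉ H := by
    intro v hv h
    rw [hf] at h
    have : c * (v * y₀) ∈ H := by simpa [mul_assoc] using h
    exact ((mul_mem_iff_not_mem hcH hH _).1 this) (H.mul_mem (hVH ((hmemV v).1 hv)) hy₀H)
  have hdisj : Disjoint VF (VF.image f) := by
    rw [Finset.disjoint_left]
    intro x hx hx'
    obtain ⟨v, hv, rfl⟩ := Finset.mem_image.1 hx'
    exact hfH v hv (hVH ((hmemV _).1 hx))
  have hcardD : (VF ∪ VF.image f).card = 2 * VF.card := by
    rw [Finset.card_union_of_disjoint hdisj, Finset.card_image_of_injective _ hfinj, two_mul]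
  rw [hcardD, Finset.filter_union, Finset.card_union_of_disjoint
    (Finset.disjoint_filter_filter hdisj), Finset.filter_image, Finset.card_image_of_injective _ hfinj]
  -- count on each half
  by_cases hg : g ∈ H
  · -- `v g ∈ S ↔ v g ∈ N`;  `c v y₀ g ∈ S ↔ v (y₀ g) ∉ N`
    have h1 : (VF.filter fun x => x * g ∈ S) = VF.filter fun v => v * g ∈ N := by
      refine Finset.filter_congr fun v hv => ?_
      exact mem_halfSystem_iff_of_mem hS (H.mul_mem (hVH ((hmemV v).1 hv)) hg)
    have h2 : (VF.filter fun v => f v * g ∈ S) = VF.filter fun v => v * (y₀ * g) ∉ N := by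
      refine Finset.filter_congr fun v hv => ?_
      have hout : f v * g ∉ H := fun h =>
        hfH v hv (by simpa using H.mul_mem h (H.inv_mem hg))
      rw [mem_halfSystem_iff_of_not_mem hNH hS hout, hf]
      simp only
      rw [show c * (c * v * y₀ * g) = v * (y₀ * g) by
        rw [← mul_assoc, ← mul_assoc, ← mul_assoc c c v, hcc, one_mul, mul_assoc]]
    rw [h1, h2, card_filter_mul_mem_eq_one hT hmemV hg]
    have := card_filter_mul_not_mem hT hmemV (H.mul_mem hy₀H hg)
    omega
  · -- `g = c g'`, `g' ∈ H`: `v g ∈ S ↔ v g' ∉ N`;  `c v y₀ g ∈ S ↔ v (y₀ g') ∈ N`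
    have hg' : c * g ∈ H := (mul_mem_iff_not_mem hcH hH g).2 hg
    have h1 : (VF.filter fun x => x * g ∈ S) = VF.filter fun v => v * (c * g) ∉ N := by
      refine Finset.filter_congr fun v hv => ?_
      have hvH : v ∈ H := hVH ((hmemV v).1 hv)
      have hout : v * g ∉ H := fun h => hg (by simpa using H.mul_mem (H.inv_mem hvH) h)
      rw [mem_halfSystem_iff_of_not_mem hNH hS hout, ← mul_assoc, hcz v, mul_assoc]
    have h2 : (VF.filter fun v => f v * g ∈ S) = VF.filter fun v => v * (y₀ * (c * g)) ∈ N := by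
      refine Finset.filter_congr fun v hv => ?_
      have hvH : v ∈ H := hVH ((hmemV v).1 hv)
      have heq : f v * g = v * (y₀ * (c * g)) := by
        change c * v * y₀ * g = v * (y₀ * (c * g))
        rw [hcz v, mul_assoc v c y₀, hcz y₀, mul_assoc v (y₀ * c) g, mul_assoc y₀ c g]
      rw [heq]
      exact mem_halfSystem_iff_of_mem hS (H.mul_mem hvH (H.mul_mem hy₀H hg'))
    rw [h1, h2, card_filter_mul_mem_eq_one hT hmemV (H.mul_mem hy₀H hg')]
    have := card_filter_mul_not_mem hT hmemV hg'
    omega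

/-- `#D = 2|V|` for `D = V ∪ c·V·y₀` (`V ≤ H`, `c ∉ H`: the two halves are disjoint). [cite: Dodson1984, §3.1.1] -/
theorem card_balancedSet (hcH : c ∉ H) (hH : ∀ g : G, g ∈ H ∨ c * g ∈ H) (hVH : V ≤ H) (hy₀H : y₀ ∈ H) :
    ((Finset.univ.filter fun x : G => x ∈ V) ∪
        (Finset.univ.filter fun x : G => x ∈ V).image fun v => c * v * y₀).card = 2 * Nat.card V := by
  set VF : Finset G := Finset.univ.filter fun x : G => x ∈ V with hVF
  have hmemV : ∀ x, x ∈ VF ↔ x ∈ V := fun x => by rw [hVF, Finset.mem_filter]; simp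
  have hVFc : VF.card = Nat.card V := by rw [hVF, Nat.card_eq_fintype_card, ← Fintype.card_subtype]
  have hfinj : Function.Injective fun v : G => c * v * y₀ := by
    intro a b h
    have h' : c * a * y₀ = c * b * y₀ := h
    exact mul_left_cancel (mul_right_cancel h')
  have hdisj : Disjoint VF (VF.image fun v => c * v * y₀) := by
    rw [Finset.disjoint_left]
    intro x hx hx'
    obtain ⟨v, hv, rfl⟩ := Finset.mem_image.1 hx'
    have h1 : c * (v * y₀) ∈ H := by simpa [mul_assoc] using hVH ((hmemV _).1 hx)
    exact ((mul_mem_iff_not_mem hcH hH _).1 h1) (H.mul_mem (hVH ((hmemV v).1 hv)) hy₀H)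
  rw [Finset.card_union_of_disjoint hdisj, Finset.card_image_of_injective _ hfinj, hVFc, two_mul]

/-- `1 ∈ D` and `c ∉ D` for `D = V ∪ c·V·y₀`, `y₀ ∉ V`: the balanced weight is NOT invariant under `x ↦ c x`.
[cite: Gordon1999HodgeAVSurvey, 9.2.2] -/
theorem one_mem_and_not_mem (hcH : c ∉ H) (hVH : V ≤ H) (hy₀V : y₀ ∉ V) :
    (1 : G) ∈ ((Finset.univ.filter fun x : G => x ∈ V) ∪
        (Finset.univ.filter fun x : G => x ∈ V).image fun v => c * v * y₀) ∧
      c ∉ ((Finset.univ.filter fun x : G => x ∈ V) ∪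
        (Finset.univ.filter fun x : G => x ∈ V).image fun v => c * v * y₀) := by
  constructor
  · exact Finset.mem_union_left _ (by simp [V.one_mem])
  · intro h
    rcases Finset.mem_union.1 h with h | h
    · simp only [Finset.mem_filter, Finset.mem_univ, true_and] at h
      exact hcH (hVH h)
    · obtain ⟨v, hv, hcv⟩ := Finset.mem_image.1 h
      simp only [Finset.mem_filter, Finset.mem_univ, true_and] at hv
      have : v * y₀ = 1 := by
        have h' : c * (v * y₀) = c * 1 := by rw [mul_one, ← mul_assoc]; exact hcv
        exact mul_left_cancel h'
      apply hy₀V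
      have : y₀ = v⁻¹ := eq_inv_of_mul_eq_one_right this
      rw [this]; exact V.inv_mem hv

/-- `2|N| ≠ |H|` for a right transversal `N` of a subgroup `V ≤ H` with at least three elements
(`|N|·|V| = |H|`, part I). [cite: Dodson1984, §3.1.1] -/
theorem two_mul_card_ne (hVH : V ≤ H) (h3 : 3 ≤ Nat.card V) (hNH : ∀ n ∈ N, n ∈ H)
    (hT : ∀ y ∈ H, ∃ v ∈ V, v * y ∈ N ∧ ∀ v' ∈ V, v' * y ∈ N → v' = v) : 2 * N.card ≠ Nat.card H := by
  have hmul := card_mul_card_eq hVH hNH hT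
  have hpos : 0 < N.card := by
    obtain ⟨v, -, hv1, -⟩ := hT 1 H.one_mem
    exact Finset.card_pos.2 ⟨_, hv1⟩
  intro h
  rw [← hmul] at h
  have : Nat.card V = 2 := by
    have := Nat.eq_of_mul_eq_mul_left hpos (h.symm.trans (mul_comm _ _))
    omega
  omega

end HalfSystem

/-! ## §4 Package: subgroup data ⟹ a CM set with trivial stabiliser and a balanced set moved by `c` -/

/-- **Parts I + II packaged.**  `G` finite, `c` a central involution, `H ≤ G` with `c ∉ H` and `G = H ∪ cH`;
`V ≤ H` with `3 ≤ |V|`; `y₀ ∈ H ∖ V` with `y₀² ≠ 1`.  Then there are a CM set `S ⊆ G` for `c` with trivial left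
stabiliser and a finset `D` of `2|V|` elements with `2·#{x ∈ D : x g ∈ S} = #D` for every `g`, `1 ∈ D`, `c ∉ D`.
[cite: Dodson1984, §3.1.1] [cite: Shimura1998, §8.2 Prop. 26] -/
theorem exists_halfSystem_of_subgroup [Fintype G] {c : G} {H V : Subgroup G} {y₀ : G} (hcc : c * c = 1)
    (hcz : ∀ g : G, c * g = g * c) (hcH : c ∉ H) (hH : ∀ g : G, g ∈ H ∨ c * g ∈ H) (hVH : V ≤ H)
    (h3 : 3 ≤ Nat.card V) (hy₀H : y₀ ∈ H) (hy₀V : y₀ ∉ V) (hy₀2 : y₀ * y₀ ≠ 1) :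
    ∃ S D : Finset G, (∀ g : G, g ∈ S ↔ c * g ∉ S) ∧ (∀ v : G, v ≠ 1 → ∃ w : G, ¬ (w ∈ S ↔ v * w ∈ S)) ∧
      (∀ g : G, 2 * (D.filter fun x => x * g ∈ S).card = D.card) ∧ (1 : G) ∈ D ∧ c ∉ D ∧
      D.card = 2 * Nat.card V := by
  obtain ⟨N, hNH, -, hT, hN1⟩ := exists_transversal hVH h3 hy₀H hy₀V hy₀2
  obtain ⟨S, hS⟩ := exists_halfSystem c H N
  obtain ⟨h1D, hcD⟩ := one_mem_and_not_mem hcH hVH hy₀V (c := c) (y₀ := y₀)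
  exact ⟨S, _, isCM_halfSystem hcc hcH hH hNH hS,
    exists_not_iff_of_halfSystem hcc hcz hcH hH hNH hS hN1 (two_mul_card_ne hVH h3 hNH hT),
    two_mul_card_filter_halfSystem hcc hcz hcH hH hVH hNH hT hS hy₀H, h1D, hcD, card_balancedSet hcH hH hVH hy₀H⟩

end Literature.NumberTheory.ComplexMultiplication.TwiceOdd
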